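import Literature.NumberTheory.EllipticCurves.CastellaGrossiLeeSkinner2022.BDPValueAtTrivialCharacter
import Literature.NumberTheory.EllipticCurves.HeegnerFieldDescentProofs
import Literature.NumberTheory.EllipticCurves.FormalGroupPadicLogPointProofs
import Literature.NumberTheory.EllipticCurves.SupersingularIrreducibleProofs
import HarnessLib

set_option autoImplicit false

/-!
# The two links of a BDP-type `p`-converse at the trivial character, in the NON-VANISHING currency:
# anticyclotomic control (`𝓕(0) ≠ 0`) and main conjecture ∘ `p`-adic Waldspurger formula
# (`𝓕(0) = u · log_{ω_E}(P_K)²`, `u ≠ 0`) — and the elementary deduction "⟹ `P_K` is non-torsion"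

Trunk `Literature/NumberTheory/EllipticCurves`. Cell `bsd-cn100` (HOME `run/shared/lean/pub/bsd-cn100/`),
typer seat `bsd-cn100-ty` g2, for the rungs S2 / S2b of `Summits/BirchSwinnertonDyer` (routes
`CongruentShaFreeCut`, `MordellShaFreeCut`; cruxes `AnalyticRankOneOfRankOneFiniteSha{Two,Three}`):
the plan seat asked for the research stub of crux B to be SPLIT "into (MC side) corank 1 ⟹ 𝓛_p(𝟙) ≠ 0
and (ERL side) 𝓛_p(𝟙) = unit·log_ω(y_K)² over a TYPED p-adic object at the additive prime" (HANDOFF §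
plan g9; s2-c3's T3 memo §2). This file supplies the GENERIC, curve- and prime-independent half of
that split; the `E_n`/`p = 2` and `j = 0`/`p = 3` leaves are Summits-side (prover-filed). DEFINITIONS
with bodies and PROVED theorems only — no named fact, nothing asserted, no `sorry` (D-0014/D-0026).

## The device: no `p`-adic `L`-function object (every symbol a tree object)

The printed proofs of a `p`-converse in the Heegner/BDP architecture (Skinner 2020; Burungale–Tian
2020; Castella–Grossi–Lee–Skinner 2022 §5.2, proof of Thm. 5.2.1; Burungale–Kobayashi–Ota 2024 §4.1.4)
run: (1) CONTROL — from `rank E(K) = 1`, `#Ш(E/K)[p^∞] < ∞` the anticyclotomic Selmer dual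
`𝔛 = X_ac(E[p^∞])` (relaxed at `v`, strict at `v̄`) is `Λ`-torsion with `𝓕(0) ≠ 0` for a generator `𝓕`
of `char_Λ 𝔛` (CGLS Thm. 5.1.1, Jetchev–Skinner–Wan Thm. 3.3.1, Castella 2018 Thm. 2.3 — with the
exact valuation of `𝓕(0)`); (2) MAIN CONJECTURE `char_Λ(𝔛)Λ^ur = (𝓛_p)` (CGLS Thm. 4.2.2, BCS 2025,
…); (3) the `p`-adic WALDSPURGER/BDP formula `𝓛_p(𝟙) = c · log_{ω_E}(P_K)²`, `c ≠ 0` (BDP 2013 Thm.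
5.13, CGLS Thm. 5.1.3, Castella 2018 Thm. 3.2); (4) `log_{ω_E}(P_K) ≠ 0 ⟹ P_K` non-torsion ⟹
Gross–Zagier. The tree types (1) and (2)∘(3) ON REAL OBJECTS, eliminating `𝓛_p` by evaluating the
main conjecture at `𝟙` (CGLS display (5.4)): `thm511_anticyclotomicControl`,
`display54_thm513_generator_constantCoeff` (this directory's `CastellaGrossiLeeSkinner2022/`), in the
VALUATION currency `AcSelmer.XAc.HasCharValuationAt … n` (the `p`-part of BSD needs `ord_p`). A
`p`-CONVERSE needs only the NON-VANISHING currency: (1′) `∃ n, HasCharValuationAt … n` (i.e. `𝔛`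
torsion and `𝓕(0) ≠ 0`; the tree's predicate, reused, not restated) and (2∘3′) `𝓕(0) = u · log²` for
SOME NON-ZERO `u ∈ ℚ_p` — the predicate `CharValueEqLogSqAt` below (display (5.4) ∘ Thm. 5.1.3 with
the printed constant `u ∈ ℤ_p^× · c_E⁻² (1 − a_p p⁻¹ + p⁻¹)²` weakened to `u ≠ 0`, the only part step
(4) consumes). Step (4) is then the THEOREM `not_isOfFinAddOrder_of_links` (two generators of one
principal ideal of `Λ = ℤ_p⟦T⟧` differ by a unit, `AcSelmer.valuation_constantCoeff_eq_of_span_singleton_eq`;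
a torsion point has vanishing formal logarithm, `padicLogPoint_formalIndex_smul_eq_zero_of_isOfFinAddOrder`,
Silverman AEC IV.6.4 / VII.2.2 — elementary: no height, no regulator, so the barrier
`PAdicHeightNondegeneracy` is not met). The descent of the rank-one data to the auxiliary field
(Kato on the twist) is `rank_corank_sha_baseChange_of_twist_L_one_ne_zero`.

At a prime of ADDITIVE reduction (the rungs S2: `E_n` at `2`; S2b: `j = 0` at `3`) neither link is
in print; the Summits leaves quantify (1′) and (2∘3′) over the anticyclotomic data exactly as the
binders of `display54_thm513_generator_constantCoeff` do, and the glue there is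
`not_isOfFinAddOrder_of_links` at a datum that EXISTS (anticyclotomic `ℤ_p`-extension, degree-one
prime, the embedding it induces — `Summits/…/Rank1Residual` non-vacuity lemmas).

§4 (appended) checks the cut against print: at CGLS's good Eisenstein prime the two typed theorems
`thm511_anticyclotomicControl` and `display54_thm513_generator_constantCoeff` ARE the two links and,
through `not_isOfFinAddOrder_of_links`, make the Heegner point non-torsion under `rank E(K) = 1 ∧
#Ш(E/K)[p^∞] < ∞` (`heegnerPoint_not_isOfFinAddOrder_of_thm511_of_display54`) — the Heegner-point step of
the printed proof of CGLS Thm. 5.2.1, re-derived.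

## References
* [CastellaGrossiLeeSkinner2022] F. Castella, G. Grossi, J. Lee, C. Skinner, Invent. Math. 227 (2022):
  Thm. 5.1.1, Thm. 5.1.3, display (5.4), §5.2 (proof of Thm. 5.2.1).
* [Castella2018] F. Castella, Camb. J. Math. 6 (2018): Def. 2.2, Thm. 2.3, Thm. 3.2 (arXiv:1704.06608
  pp. 5, 9).
* [BertoliniDarmonPrasanna2013] Duke Math. J. 162 (2013), Thm. 5.13.
* [Greenberg1999LNM] LNM 1716, §1 (corank identity). [Kato2004Asterisque] Cor. 14.3.
* [SilvermanAEC2009] IV.6.4, VII.2.2.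
-/

noncomputable section

open scoped Classical

open WeierstrassCurve NumberField IsDedekindDomain Field Literature.NumberTheory.EllipticCurves
  Literature.NumberTheory.EllipticCurves.Castella2018

namespace Literature.NumberTheory.EllipticCurves.AcPConverseLinks

universe u

variable {K : Type} [Field K] [NumberField K]

/-! ### §1. The analytic link at a datum, non-vanishing currency (a predicate; nothing asserted) -/

/-- **(IMC ∘ BDP) at the trivial character, up to a NON-ZERO scalar, AT A DATUM — every symbol a tree
object.** For `W/ℚ` globally minimal (so `ω = dx/(2y + a₁x + a₃)` is a Néron differential), a prime `p`,
the anticyclotomic `ℤ_p`-extension `κ` of `K` with topological generator `γ`, the STRICT prime `𝔭`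
(`= v̄`), an embedding `ι : K ↪ ℚ_p` (meant: inducing the OTHER prime `v` above `p`) and a point
`P ∈ E(K)` (meant: a Heegner point `P_K`): the Selmer dual `𝔛 = X_ac(E[p^∞])` (relaxed at `v`, strict
at `v̄`; `AcSelmer.XAc (W_K) p κ 𝔭 ∅ γ`) is `Λ`-torsion and some generator `𝓕` of `char_Λ 𝔛` has
`𝓕(0) = u · (log_W(z(m₀ • P_ι))/m₀)²` with `u ∈ ℚ_p`, `u ≠ 0` (`P_ι = padicPointOf`, `m₀ = formalIndex`,
`log_W ∘ z = padicLogPoint`). This is the SHAPE of Castella–Grossi–Lee–Skinner 2022 display (5.4) ∘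
Thm. 5.1.3 (`display54_thm513_generator_constantCoeff`: "`𝓕_E(0) = u · 𝓛_E(0)`, `u ∈ (ℤ_p^ur)^×`" and
"`𝓛_E(0) = c_E⁻² · (1 − a_p p⁻¹ + p⁻¹)² · log_{ω_E}(P_K)²`") and of Castella 2018 Thm. 3.2 ("up to a
`p`-adic unit `L_p(f,𝟙) = (1 − a_p p⁻¹ + ε_p)² · (log_{ω_E} P_K)²`"), with the printed constant WEAKENED
to "non-zero" — the part a `p`-converse consumes. A predicate with parameters; nothing asserted; its
instances at additive primes are OPEN and live under `Summits/`.
[cite: CastellaGrossiLeeSkinner2022, Thm. 5.1.3 and display (5.4) (shape only; nothing asserted)]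
[cite: Castella2018, Thm. 3.2 (arXiv:1704.06608 p. 9) (shape only; nothing asserted)] -/
def CharValueEqLogSqAt (W : WeierstrassCurve ℚ) [W.IsElliptic] [W.IsGloballyMinimal] (p : ℕ)
    [Fact p.Prime] (κ : ZpExtension K p) (𝔭 : HeightOneSpectrum (𝓞 K)) (γ : absoluteGaloisGroup K)
    [Fact (κ.IsTopGenerator γ)] (ι : K →+* ℚ_[p]) (P : (W.baseChange K).toAffine.Point) : Prop :=
  Module.IsTorsion (IwasawaAlgebra p) (AcSelmer.XAc (W.baseChange K) p κ 𝔭 ∅ γ) ∧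
    ∃ F : IwasawaAlgebra p, AcSelmer.XAc.charIdeal (W.baseChange K) p κ 𝔭 ∅ γ = Ideal.span {F} ∧
      ∃ u : ℚ_[p], u ≠ 0 ∧
        ((PowerSeries.constantCoeff F : ℤ_[p]) : ℚ_[p]) =
          u * ((W.baseChange ℚ_[p]).padicLogPoint (formalIndex W p • padicPointOf W p ι P) /
              (formalIndex W p : ℚ_[p])) ^ 2

/-- **The printed instance**: CGLS 2022 display (5.4) ∘ Thm. 5.1.3
(`display54_thm513_generator_constantCoeff`, good Eisenstein non-anomalous `p > 2`, (Heeg), (spl),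
(disc), (Sel)) gives `CharValueEqLogSqAt` at the printed data, with
`u = unit · c_E⁻² · (1 − a_p p⁻¹ + p⁻¹)²`. The two non-vanishing inputs are kept as hypotheses: `hE`,
`1 − a_p p⁻¹ + p⁻¹ ≠ 0` (it is `(p + 1 − a_p)/p`, non-zero by the Hasse bound), and `hc`, the Manin
constant `c_E ≠ 0`. This makes the weakening "printed constant ⟹ some non-zero `u`" explicit.
[cite: CastellaGrossiLeeSkinner2022, Thm. 5.1.3 and display (5.4)] -/
theorem charValueEqLogSqAt_of_display54
    (h54 : CastellaGrossiLeeSkinner2022.display54_thm513_generator_constantCoeff)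
    (W : WeierstrassCurve ℚ) [W.IsElliptic] [W.IsGloballyMinimal] (p : ℕ) [Fact p.Prime]
    (hp : 2 < p) (hgood : Rank1Residual.Good W p) (hred : Rank1Residual.Red W p)
    (hna : ¬ Rank1Residual.Anom W p) (hK : IsImaginaryQuadratic K)
    (hHN : SatisfiesHeegnerHypothesis (W.conductorNorm ℤ) K) (hHp : SatisfiesHeegnerHypothesis p K)
    (hodd : Odd (NumberField.discr K)) (h3 : NumberField.discr K ≠ -3)
    (hSel : (W.baseChange K).selmerCorank p = 1)
    (ι : K →+* ℚ_[p]) (v vbar : HeightOneSpectrum (𝓞 K))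
    (hv : ∀ x : 𝓞 K, x ∈ v.asIdeal ↔ ‖ι (x : K)‖ < 1) (hvbar : ((p : ℕ) : 𝓞 K) ∈ vbar.asIdeal)
    (hne : vbar ≠ v) (κ : ZpExtension K p) (hκ : κ.IsAnticyclotomic) (γ : absoluteGaloisGroup K)
    [Fact (κ.IsTopGenerator γ)] (N : ℕ) [NeZero N] (Dt : ModularForms.ModularParametrizationData W N)
    (H : HeegnerDatum N (NumberField.discr K)) (ιC : K →+* ℂ)
    (P : (W.baseChange K).toAffine.Point)
    (hP : WeierstrassCurve.Affine.Point.map ιC.toRatAlgHom P = ModularForms.heegnerPointComplex Dt H)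
    (hE : (1 - (W.frobeniusTrace p : ℚ_[p]) * (p : ℚ_[p])⁻¹ + (p : ℚ_[p])⁻¹) ≠ 0)
    (hc : (Dt.c : ℚ_[p]) ≠ 0) :
    CharValueEqLogSqAt W p κ vbar γ ι P := by
  obtain ⟨htors, F, hF, u, hu⟩ :=
    h54 W p hp hgood hred hna K hK hHN hHp hodd h3 hSel ι v vbar hv hvbar hne κ hκ γ N Dt H ιC P hP
  refine ⟨htors, F, hF, ((u : ℤ_[p]) : ℚ_[p]) * ((Dt.c : ℚ_[p])⁻¹) ^ 2 *
    (1 - (W.frobeniusTrace p : ℚ_[p]) * (p : ℚ_[p])⁻¹ + (p : ℚ_[p])⁻¹) ^ 2, ?_, ?_⟩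
  · have hu0 : ((u : ℤ_[p]) : ℚ_[p]) ≠ 0 := by
      rw [Ne, PadicInt.coe_eq_zero]
      exact u.ne_zero
    exact mul_ne_zero (mul_ne_zero hu0 (pow_ne_zero _ (inv_ne_zero hc))) (pow_ne_zero _ hE)
  · rw [hu]

/-! ### §2. Elementary inputs (PROVED) -/

/-- **The formal logarithm is additive on `E₁(ℚ_p)`, iterated**: for a globally minimal `W/ℚ` read over
`ℚ_p` and `Q ∈ E₁(ℚ_p)`, every multiple `m • Q` lies in `E₁(ℚ_p)` and `log_W(z(m • Q)) = m · log_W(z(Q))`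
(induction on `m` from the tree's `padicLogPoint_add_holds`, AEC VII.2.2 + IV.6.4(a), and
`log_W(z(O)) = 0`). [cite: SilvermanAEC2009, VII.2.2 and IV.6.4] -/
theorem padicLogPoint_nsmul (W : WeierstrassCurve ℚ) [W.IsElliptic] [W.IsGloballyMinimal] (p : ℕ)
    [Fact p.Prime] (Q : (W.baseChange ℚ_[p]).toAffine.Point)
    (hQ : (W.baseChange ℚ_[p]).IsInReductionKernel Q) (m : ℕ) :
    (W.baseChange ℚ_[p]).IsInReductionKernel (m • Q) ∧
      (W.baseChange ℚ_[p]).padicLogPoint (m • Q) = (m : ℚ_[p]) * (W.baseChange ℚ_[p]).padicLogPoint Q := by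
  haveI : (W.baseChange ℚ_[p]).IsMinimal ℤ_[p] := isMinimal_map_padic_of_isGloballyMinimal W p
  induction m with
  | zero =>
    refine ⟨by rw [zero_nsmul]; exact (W.baseChange ℚ_[p]).isInReductionKernel_zero, ?_⟩
    rw [zero_nsmul, Nat.cast_zero, zero_mul, WeierstrassCurve.padicLogPoint_zero]
  | succ m ih =>
    obtain ⟨hmem, hlog⟩ := ih
    obtain ⟨hmem', hlog'⟩ := padicLogPoint_add_holds p (W.baseChange ℚ_[p]) (m • Q) Q hmem hQ
    refine ⟨by rw [succ_nsmul]; exact hmem', ?_⟩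
    rw [succ_nsmul, hlog', hlog, Nat.cast_succ]
    ring

/-- **A torsion point has vanishing `p`-adic logarithm**: for `W/ℚ` globally minimal, `ι : K ↪ ℚ_p` and
`P ∈ E(K)` of finite order, `log_W(z(m₀ • P_ι)) = 0` — `m₀ • P_ι ∈ E₁(ℚ_p)` (`m₀` is the index of
`E₁(ℚ_p)`, `AddSubgroup.nsmul_index_mem`), `k • P = O` for some `k > 0`, and `k · log(m₀ • P_ι) =
log(O) = 0` by `padicLogPoint_nsmul`. [cite: SilvermanAEC2009, IV.6.4 and VII.2.2] -/
theorem padicLogPoint_formalIndex_smul_eq_zero_of_isOfFinAddOrder (W : WeierstrassCurve ℚ)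
    [W.IsElliptic] [W.IsGloballyMinimal] (p : ℕ) [Fact p.Prime] (ι : K →+* ℚ_[p])
    {P : (W.baseChange K).toAffine.Point} (hP : IsOfFinAddOrder P) :
    (W.baseChange ℚ_[p]).padicLogPoint (formalIndex W p • padicPointOf W p ι P) = 0 := by
  have hPι : IsOfFinAddOrder (padicPointOf W p ι P) := by
    unfold padicPointOf
    exact AddMonoidHom.isOfFinAddOrder _ hP
  set Q := formalIndex W p • padicPointOf W p ι P with hQdef
  have hQ : IsOfFinAddOrder Q := hPι.nsmul
  have hQmem : (W.baseChange ℚ_[p]).IsInReductionKernel Q :=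
    (((W.baseChange ℚ_[p]).mem_formalFiltration_iff).mp
      (AddSubgroup.nsmul_index_mem ((W.baseChange ℚ_[p]).formalFiltration 1)
        (padicPointOf W p ι P))).1
  obtain ⟨k, hk, hkQ⟩ := hQ.exists_nsmul_eq_zero
  have hlog := (padicLogPoint_nsmul W p Q hQmem k).2
  rw [hkQ, WeierstrassCurve.padicLogPoint_zero] at hlog
  have hk0 : (k : ℚ_[p]) ≠ 0 := by exact_mod_cast hk.ne'
  rcases mul_eq_zero.mp hlog.symm with h | h
  · exact absurd h hk0
  · exact h

/-- **Descent of the rank-one data to the auxiliary field.** For `E/ℚ` elliptic, `p` prime, `K`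
imaginary quadratic with `L(E^{(d_K)}, 1) ≠ 0`, `rank E(ℚ) = 1` and `#Ш(E/ℚ)[p^∞] < ∞`: by Kato
(`hKato`: the twist has finitely many rational points and finite `p^∞`-Selmer group) and the
quadratic base-change identities (`mordellWeilRank_baseChange_quadratic_holds`,
`selmerCorank_baseChange_quadratic_holds`), `rank E(K) = 1` and `corank_{ℤ_p} Sel_{p^∞}(E/K) = 1`, hence
`#Ш(E/K)[p^∞] < ∞` (Greenberg's identity `corank Sel = rank + corank Ш`,
`selmerCorank_eq_mordellWeilRank_add_holds`). The `K`-fixed form of the data of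
`exists_heegnerField_descent_of_mordellWeilRank_eq_one_of_finite_sha`.
[cite: Greenberg1999LNM, §1 pp. 54–57] [cite: Kato2004Asterisque, Cor. 14.3 (p. 235)] -/
theorem rank_corank_sha_baseChange_of_twist_L_one_ne_zero
    (hKato : ∀ (W : WeierstrassCurve ℚ) [W.IsElliptic] (p : ℕ) [Fact p.Prime],
      kato_finite_of_L_one_ne_zero W p)
    (W : WeierstrassCurve ℚ) [W.IsElliptic] (p : ℕ) [Fact p.Prime] (hK : IsImaginaryQuadratic K)
    (hL : (W.quadraticTwist (NumberField.discr K : ℚ)).entireLFunction 1 ≠ 0)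
    (hrank : W.mordellWeilRank = 1) (hsha : Finite (AddCommGroup.primaryComponent W.sha p)) :
    (W.baseChange K).mordellWeilRank = 1 ∧ (W.baseChange K).selmerCorank p = 1 ∧
      Finite (AddCommGroup.primaryComponent (W.baseChange K).sha p) := by
  have hd : (NumberField.discr K : ℚ) ≠ 0 := by exact_mod_cast NumberField.discr_ne_zero K
  haveI := W.isElliptic_quadraticTwist hd
  haveI : (W.baseChange K).IsElliptic := by rw [baseChange]; infer_instance
  obtain ⟨hfinpt, -, hfinSel⟩ := hKato (W.quadraticTwist (NumberField.discr K : ℚ)) p hL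
  haveI := hfinSel
  have hrk : (W.baseChange K).mordellWeilRank = 1 := by
    rw [mordellWeilRank_baseChange_quadratic_holds W K hK.1,
      mordellWeilRank_eq_zero_of_finite _ hfinpt, add_zero, hrank]
  have hcork : (W.baseChange K).selmerCorank p = 1 := by
    rw [selmerCorank_baseChange_quadratic_holds W K hK.1 p,
      (W.quadraticTwist (NumberField.discr K : ℚ)).selmerCorank_eq_zero_of_finite p, add_zero,
      selmerCorank_eq_one_of_mordellWeilRank_eq_one_of_finite W p hrank hsha]
  refine ⟨hrk, hcork, ?_⟩
  rw [finite_primaryComponent_sha_iff_shaCorank_eq_zero (W.baseChange K) p]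
  have h := (W.baseChange K).selmerCorank_eq_mordellWeilRank_add_holds p
  omega

/-! ### §3. Step (4) of the printed proofs: the two links force the point to be non-torsion (PROVED) -/

/-- **The two links at one datum imply `P` is not torsion.** If `𝔛` is `Λ`-torsion with a generator
`𝓕_A` of `char_Λ 𝔛` having `𝓕_A(0) ≠ 0` (the tree's currency `∃ n, AcSelmer.XAc.HasCharValuationAt … n`,
the shape of CGLS Thm. 5.1.1's conclusion) and some generator `𝓕_B` has `𝓕_B(0) = u · log²(m₀ • P_ι)/m₀²`
with `u ≠ 0` (`CharValueEqLogSqAt`), then `P` has infinite order: generators of one principal ideal of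
the domain `Λ = ℤ_p⟦T⟧` differ by a unit, so `𝓕_B(0) ≠ 0`, so `log_W(z(m₀ • P_ι)) ≠ 0`, which fails for
a torsion `P` (`padicLogPoint_formalIndex_smul_eq_zero_of_isOfFinAddOrder`). This is the step "`κ_1 ≠ 0`
⟹ `P_K` non-torsion" / "`log_{ω_E} P_K ≠ 0`" of CGLS §5.2 and of every BDP-type `p`-converse; no height
or regulator enters. [cite: CastellaGrossiLeeSkinner2022, §5.2 (proof of Thm. 5.2.1)]
[cite: SilvermanAEC2009, IV.6.4 and VII.2.2] -/
theorem not_isOfFinAddOrder_of_links (W : WeierstrassCurve ℚ) [W.IsElliptic] [W.IsGloballyMinimal]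
    (p : ℕ) [Fact p.Prime] (κ : ZpExtension K p) (𝔭 : HeightOneSpectrum (𝓞 K))
    (γ : absoluteGaloisGroup K) [Fact (κ.IsTopGenerator γ)] (ι : K →+* ℚ_[p])
    (P : (W.baseChange K).toAffine.Point)
    (hA : ∃ n : ℕ, AcSelmer.XAc.HasCharValuationAt (W.baseChange K) p κ 𝔭 ∅ γ n)
    (hB : CharValueEqLogSqAt W p κ 𝔭 γ ι P) : ¬ IsOfFinAddOrder P := by
  intro hPtor
  obtain ⟨n, -, FA, hFA, hFA0, -⟩ := hA
  obtain ⟨-, FB, hFB, u, hu, hval⟩ := hB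
  have hFB0 : PowerSeries.constantCoeff FB ≠ 0 :=
    (AcSelmer.valuation_constantCoeff_eq_of_span_singleton_eq (hFA.symm.trans hFB) hFA0).1
  rw [padicLogPoint_formalIndex_smul_eq_zero_of_isOfFinAddOrder W p ι hPtor, zero_div,
    zero_pow two_ne_zero, mul_zero] at hval
  exact hFB0 (PadicInt.coe_eq_zero.mp hval)

/-- **The non-vanishing currency from the tree's `∃ 𝓕` shape**: a torsion `𝔛` with a principal
characteristic ideal `(𝓕)`, `𝓕(0) ≠ 0`, satisfies `∃ n, HasCharValuationAt … n` (with
`n = ord_p 𝓕(0)`); how a control-type leaf stated with its own `∃ 𝓕` feeds `not_isOfFinAddOrder_of_links`.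
[cite: Castella2018, Thm. 2.3 (arXiv:1704.06608 p. 5) (shape)] -/
theorem exists_hasCharValuationAt_of_constantCoeff_ne_zero {L : Type u} [Field L] [NumberField L]
    (W : WeierstrassCurve L) (p : ℕ) [Fact p.Prime] (κ : ZpExtension L p)
    (𝔭 : HeightOneSpectrum (𝓞 L)) (γ : absoluteGaloisGroup L) [Fact (κ.IsTopGenerator γ)]
    (htors : Module.IsTorsion (IwasawaAlgebra p) (AcSelmer.XAc W p κ 𝔭 ∅ γ))
    {F : IwasawaAlgebra p} (hF : AcSelmer.XAc.charIdeal W p κ 𝔭 ∅ γ = Ideal.span {F})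
    (hF0 : PowerSeries.constantCoeff F ≠ 0) :
    ∃ n : ℕ, AcSelmer.XAc.HasCharValuationAt W p κ 𝔭 ∅ γ n :=
  ⟨(PowerSeries.constantCoeff F).valuation, htors, F, hF, hF0, rfl⟩

/-! ### §4. The printed instance of the whole cut: at a good Eisenstein prime the two typed CGLS
theorems ARE the two links, and they force the Heegner point to be non-torsion (PROVED) -/

/-- **The cut reproduces print.** At the data of Castella–Grossi–Lee–Skinner 2022 — `W/ℚ` globally
minimal, `p > 2` a GOOD Eisenstein prime (`Good`, `Red`) with `φ|_{G_p} ≠ 𝟙, ω` (`¬ Anom`), `K`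
imaginary quadratic with (Heeg) for `N_E` and (spl) for `p`, (disc) `d_K` odd `≠ −3`, an embedding
`ι : K ↪ ℚ_p` inducing `v`, `v̄ ≠ v` above `p`, the anticyclotomic `κ` with topological generator `γ`,
`E(ℚ_p)[p] = 0`, a modular parametrisation `Dt` with Manin constant `c ≠ 0` (read in `ℚ_p`), a Heegner
datum `H` and a point `P ∈ E(K)` mapping to the Heegner point `P_K` — the HYPOTHESES OF A `p`-CONVERSE,
`rank_ℤ E(K) = 1` and `#Ш(E/K)[p^∞] < ∞`, make `P` NON-TORSION, granted the two typed theorems of the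
paper: Thm. 5.1.1 (`h511`, anticyclotomic control ⟹ Link A in the currency `∃ n, HasCharValuationAt … n`,
`CastellaGrossiLeeSkinner2022.hasCharValuationAt_of_thm511`, fed with ANY point of infinite order, which
exists as `rank E(K) = 1`) and display (5.4) ∘ Thm. 5.1.3 (`h54` ⟹ Link B, `charValueEqLogSqAt_of_display54`,
under (Sel), which follows from the two hypotheses by Greenberg's corank identity); then
`not_isOfFinAddOrder_of_links`. This is the Heegner-point step of the proof of CGLS Thm. 5.2.1 (Theorem E,
the Eisenstein `p`-converse — vendored whole as `CastellaGrossiLeeSkinner2022.thmE_…` in `PConverse.lean`)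
re-derived from the paper's two structural theorems: evidence that the two-link cut of the additive-prime
cruxes (`Summits/…/Theorems/{CongruentShaFreeCutTwoAdicLinks,MordellShaFreeCutThreeAdicLinks}`) is the
printed mechanism and not an ad-hoc weakening. The factor `1 − a_p p⁻¹ + p⁻¹ = (p + 1 − a_p)/p` is
non-zero by Hasse; kept as the hypothesis `hE` (as in `charValueEqLogSqAt_of_display54`).
[cite: CastellaGrossiLeeSkinner2022, §5.2 (proof of Thm. 5.2.1), Thm. 5.1.1, Thm. 5.1.3, display (5.4)] -/
theorem heegnerPoint_not_isOfFinAddOrder_of_thm511_of_display54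
    (h511 : CastellaGrossiLeeSkinner2022.thm511_anticyclotomicControl)
    (h54 : CastellaGrossiLeeSkinner2022.display54_thm513_generator_constantCoeff)
    (W : WeierstrassCurve ℚ) [W.IsElliptic] [W.IsGloballyMinimal] (p : ℕ) [Fact p.Prime]
    (hp : 2 < p) (hgood : Rank1Residual.Good W p) (hred : Rank1Residual.Red W p)
    (hna : ¬ Rank1Residual.Anom W p) (hK : IsImaginaryQuadratic K)
    (hHN : SatisfiesHeegnerHypothesis (W.conductorNorm ℤ) K) (hHp : SatisfiesHeegnerHypothesis p K)
    (hodd : Odd (NumberField.discr K)) (h3 : NumberField.discr K ≠ -3)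
    (ι : K →+* ℚ_[p]) (v vbar : HeightOneSpectrum (𝓞 K))
    (hv : ∀ x : 𝓞 K, x ∈ v.asIdeal ↔ ‖ι (x : K)‖ < 1) (hvbar : ((p : ℕ) : 𝓞 K) ∈ vbar.asIdeal)
    (hne : vbar ≠ v) (κ : ZpExtension K p) (hκ : κ.IsAnticyclotomic) (γ : absoluteGaloisGroup K)
    [Fact (κ.IsTopGenerator γ)]
    (hEp : ∀ Q : (W.baseChange ℚ_[p]).toAffine.Point, p • Q = 0 → Q = 0)
    (hrk : (W.baseChange K).mordellWeilRank = 1)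
    (hfin : Finite (AddCommGroup.primaryComponent (W.baseChange K).sha p))
    (N : ℕ) [NeZero N] (Dt : ModularForms.ModularParametrizationData W N)
    (H : HeegnerDatum N (NumberField.discr K)) (ιC : K →+* ℂ) (P : (W.baseChange K).toAffine.Point)
    (hP : WeierstrassCurve.Affine.Point.map ιC.toRatAlgHom P = ModularForms.heegnerPointComplex Dt H)
    (hE : (1 - (W.frobeniusTrace p : ℚ_[p]) * (p : ℚ_[p])⁻¹ + (p : ℚ_[p])⁻¹) ≠ 0)
    (hc : (Dt.c : ℚ_[p]) ≠ 0) : ¬ IsOfFinAddOrder P := by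
  haveI : (W.baseChange K).IsElliptic := by rw [baseChange]; infer_instance
  -- a point of infinite order exists (rank one), feeding Thm. 5.1.1
  have h1 : 1 ≤ Module.finrank ℤ (W.baseChange K).toAffine.Point := by
    change 1 ≤ (W.baseChange K).mordellWeilRank
    omega
  obtain ⟨P₀, hP₀⟩ := exists_not_isOfFinAddOrder_of_one_le_finrank h1
  -- Link A from Thm. 5.1.1 (Eisenstein ⟹ ordinary)
  obtain ⟨n, hA, -⟩ := CastellaGrossiLeeSkinner2022.hasCharValuationAt_of_thm511 h511 hp
    (Rank1Residual.goodOrd_of_red_of_good W p hp hgood hred) K hK hHp hHN ι v vbar hv hvbar hne κ hκ γ hEp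
    hrk hfin P₀ hP₀
  -- (Sel) from rank one and finite `Ш[p^∞]`
  have hSel : (W.baseChange K).selmerCorank p = 1 :=
    selmerCorank_eq_one_of_mordellWeilRank_eq_one_of_finite (W.baseChange K) p hrk hfin
  -- Link B from display (5.4) ∘ Thm. 5.1.3
  have hB := charValueEqLogSqAt_of_display54 h54 W p hp hgood hred hna hK hHN hHp hodd h3 hSel ι v vbar
    hv hvbar hne κ hκ γ N Dt H ιC P hP hE hc
  exact not_isOfFinAddOrder_of_links W p κ vbar γ ι P ⟨n, hA⟩ hB

end Literature.NumberTheory.EllipticCurves.AcPConverseLinks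

end
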